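import Mathlib
import Literature.NumberTheory.Irrationality.Lai2025TwoAdic.GeneralLinearFormsS
import Literature.NumberTheory.Transcendental.TaylorCoeffPadicDiv
import Literature.NumberTheory.Transcendental.ZudilinLemma19
import HarnessLib

/-!
# Lai 2025 (IJNT, `2`-adic zeta values), §4 for GENERAL `s`, the `A`-family: the arithmetic factor
# `Φ_n = ∏_{√(10n) < q ≤ n, {n/q} > ½} q` and the refined integrality (Lemma 4.3, Remark 4.4, and the `Φ_n`-parts of
# Lemmas 4.5–4.6: `Φ_n^{−s−2}d_n^{2s+4−i}a_{n,i,k} ∈ ℤ`, `Φ_n^{−s−2}d_n^{2s+4−i}ρ_{n,i} ∈ ℤ`, `Φ_n^{−s−2}d_n^{3s+5}ρ_{n,0} ∈ ℤ`) — PROVED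

Topic `Literature/NumberTheory/Irrationality/Lai2025TwoAdic`.  Source: L. Lai, *On the irrationality of certain
`2`-adic zeta values*, Int. J. Number Theory (2025) = arXiv:2304.00816 [Lai2025TwoAdicZeta], §4 "Arithmetic properties
of the coefficients", Lemmas 4.3–4.6 (held text `paper:arxiv-2304.00816`, chunks p0008–p0009, read on the page).
PROOF FILE (definitions with bodies + theorems; no named fact, net debt 0): third file of the groundwork for the
tree's named fact `PAdicZetaValues.lai2025TwoAdic_theorem12` ([Lai2025TwoAdicZeta, Thm 1.2]), on top of the siblings
`GeneralRationalFunctionA.lean` (`As`, `Qk`, `AsReg`, `coeffAs`, Lemma 4.2's `d_n`-part) and `GeneralLinearFormsS.lean`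
(`rhoI`, `XtermA`, `rhoZero`, the root relation `sum_XtermA_root_eq_zero`, the `d_n`-parts of Lemmas 4.5–4.6).

## Source, as printed ([Lai2025TwoAdicZeta, §4])

* **Lemma 4.3.** «For any positive integer `n` we define `Φ_n := ∏_{√(10n) < q ≤ n, {n/q} > ½} q` (def_Phi).  Here
  `{n/q}` is the fractional part of `n/q`.  When `n > (2s+4)²` and `n` is odd, we have
  `Φ_n^{−s−2} d_n^{2s+4−i} a_{n,i,k} ∈ ℤ` (`1 ≤ i ≤ 2s+4`, `0 ≤ k ≤ n`) (strong_ari_a).»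
  *Proof.* «Let `j = 2s+4−i ∈ [0,2s+3]`.  By (weak_ari_a), our goal is reduced to the following assertion: for any prime
  `q` such that `√(10n) < q ≤ n` and `{n/q} > ½`, for any `0 ≤ j ≤ 2s+3` and any `0 ≤ k ≤ n`, we have
  `v_q(a_{n,2s+4−j,k}) ≥ s+2−j` (asser). … For `j = 0`, we have
  `a_{n,2s+4,k} = Ψ_n(−k) = 2^{(6s+12)n}(−4k+2n)^δ((−k+¼)_n(−k+¾)_n/(k!²(n−k)!²))^{s+2}
   = (−4k+2n)^δ((4k)!(4n−4k)!/((2k)!(2n−2k)!k!²(n−k)!²))^{s+2}`.  To prove `v_q(a_{n,2s+4,k}) ≥ s+2`, it suffices to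
  show that `v_q((4k)!(4n−4k)!/((2k)!(2n−2k)!k!²(n−k)!²)) ≥ 1`.  Write `x = {n/q}` and `y = {k/q}`.  We have `½ < x < 1`.
  Since `q > √(10n)`, we have `v_q(…) = [4y] + [4x−4y] − [2y] − [2x−2y] − 2[y] − 2[x−y]`.  It is straightforward to
  check that the right-hand side above is at least `1` whenever `½ < x < 1` and `0 ≤ y < 1`.»  (The induction on `j`
  through the logarithmic derivative `U = Ψ_n'/Ψ_n`, (U)–(ddd): «we can see from (U^(v)) that `v_q(U^{(v)}(−k)) ≥ −1−v`.
  (We have assumed that `n` is odd, so `−k+n/2 ≠ 0` and `t = −k` is not a pole of `U(t)`.)»)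
* **Remark 4.4.** «The conclusion (strong_ari_a) still holds for any even `n > (2s+4)²` by slightly modifying the
  proof for the case `k = n/2`.»
* **Lemma 4.5.** «`Φ_n^{−s−2}d_n^{2s+4−i}ρ_{n,i} ∈ ℤ` (`1 ≤ i ≤ 2s+4`) … follows from (def_rho_i) and (strong_ari_a).»
* **Lemma 4.6.** «`Φ_n^{−s−2}d_n^{3s+5}ρ_{n,0} ∈ ℤ`»; proof: «Suppose that (rho_0_ari) is not true. … `t = −k₀+ℓ₀+¼` is
  a root of `A_n(t)` with multiplicity `s+2` … a root of `A_n^{(s+1)}(t)` … there exist `1 ≤ i₀, i₁ ≤ 2s+4` and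
  `0 ≤ k₁ ≤ n` with `k₁ ≠ k₀` and a prime `q` … On the other hand, we have by (strong_ari_a) that
  `v_q(Φ_n^{−s−2}d_n^{2s+4−i₀}a_{n,i₀,k₀}) ≥ 0`, `v_q(Φ_n^{−s−2}d_n^{2s+4−i₁}a_{n,i₁,k₁}) ≥ 0`.  It follows that
  `v_q(ℓ₀+¼) > v_q(d_n)`, `v_q(−k₀+ℓ₀+k₁+¼) > v_q(d_n)`, then `v_q(−k₀+k₁) > v_q(d_n)`.  But this contradicts
  `0 < |−k₀+k₁| ≤ n`.»

## What is formalised (all PROVED)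

* `phiPrimes n` (the primes `q ≤ n` with `10n < q²` and `2(n mod q) > q`, i.e. `√(10n) < q ≤ n`, `{n/q} > ½`) and
  **(def_Phi)** `PhiL n = Φ_n := ∏_{q ∈ phiPrimes n} q`, with `padicValNat_PhiL_of_mem` (`= 1`),
  `padicValNat_PhiL_of_not_mem` (`= 0`), `PhiL_pos`, `padicValNat_lcmUpto_of_mem_phiPrimes` (`v_q(d_n) = 1`).
* **The `j = 0` display**: `Qk_neg_eq_choose` —
  `Q_k(−k) = binom(4k,2k)binom(2k,k)binom(4(n−k),2(n−k))binom(2(n−k),n−k) = (4k)!(4n−4k)!/((2k)!(2n−2k)!k!²(n−k)!²)`,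
  so `a_{n,2s+4,k} = (2n−4k)^δ(…)^{s+2}` (`coeffAs_top_eq` of the sibling), and **the digit count** `one_le_padicValNat_qkNat`:
  `v_q(…) ≥ 1` for `q ∈ phiPrimes n` (Kummer's theorem, Mathlib's `padicValNat_choose`: a carry occurs in the lowest
  `q`-adic digit of one of the four central binomials, which is the printed «`[4y]+[4x−4y]−[2y]−[2x−2y]−2[y]−2[x−y] ≥ 1`»).
* **(asser) for every `j`**, `padicOrdGe_coeffAs_of_mem_phiPrimes`: `v_q(a_{n,i,k}) ≥ i − s − 2` for `q ∈ phiPrimes n`,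
  `k ≤ n`.  DEVIATION (flagged, mathematically equivalent bookkeeping): instead of the induction on `j` through the
  logarithmic derivative `U = Ψ_n'/Ψ_n`, the brick form `Ψ_n = (t+k)^{2s+4}A_n = Q_k^{s+2}(4t+2n)^δ` of the sibling is
  fed to the tree's divided-derivative calculus `IsDOrdDiv` ([Zudilin2004, §7, Lemmas 17–18] factor by factor: each
  linear factor `t + ℓ + a/4` or `(t+ℓ)^{−1}` of `Q_k` loses at most one `q` per derivative because `q² > 10n > |4(ℓ−k)+a|`,
  exactly the content of «`v_q(U^{(v)}(−k)) ≥ −1−v`»), so that `v_q(𝒟_jΨ_n(−k)) ≥ (s+2)·v_q(Q_k(−k)) − j`; the factor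
  `(4t+2n)^δ` is an integer polynomial and costs nothing, whence NEITHER `n` odd NOR `n > (2s+4)²` is needed (the first
  only kept `−k` off the poles of `U`, the second only served `v_q(j!) = 0`, and divided derivatives carry no `j!`) —
  this covers Remark 4.4 as well.
* **Lemma 4.3 (strong_ari_a)** `exists_int_phi_coeffAs`: `Φ_n^{−s−2}d_n^{2s+4−i}a_{n,i,k} ∈ ℤ` (every `n ≥ 1`... in fact
  every `n`, every `k ≤ n`, every `i`), prime by prime (`Rat.exists_int_of_padicOrdGe`).
* **Lemma 4.5 (rho_i_ari)** `exists_int_phi_rhoI`, and **Lemma 4.6 (rho_0_ari)** `exists_int_phi_rhoZero`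
  (`Φ_n^{−s−2}d_n^{3s+5}ρ_{n,0} ∈ ℤ`, `δ ≤ 1`): the sibling's prime-by-prime proof of the `d_n`-part
  (`exists_int_lcm_pow_mul_rhoZero`: the root relation at `m = k − ℓ`, no two bad shifts) run with the refined
  integers `Φ_n^{−s−2}d_n^{2s+4−i}a_{n,i,k}` in place of `d_n^{2s+4−i}a_{n,i,k}`, exactly as printed.

Cell zeta5-irr / pub-zeta5 (HONEST FRAMING: systematic search; no irrationality claim unless kernel-certified):
auxiliary `2`-adic material; nothing here bears on `ζ(5) ∈ ℝ`.
-/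

noncomputable section

open Finset Filter Literature.Analysis.Calculus
open Literature.NumberTheory.Transcendental
open Literature.NumberTheory.Irrationality.RivoalZudilin2020 (Greg Greg_eq Greg_isDInt)
open Literature.NumberTheory.Irrationality.LaiSprangZudilin2026.Lemma53 (Greg_neg)
open scoped Nat Topology

namespace Literature.NumberTheory.Irrationality.Lai2025TwoAdic

/-! ## §0. Divided-derivative `q`-adic orders with EXACT exponents (the value's own valuation)

For a product of elementary factors none of which vanishes at the expansion point, the exponent bookkeeping of
`IsDOrdDiv` ([Zudilin2004, Lemmas 17–18]) can be run with the exact `q`-adic valuation of each factor's value, so that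
the exponent of the product is the valuation of the product's value. -/

section Exact

variable {q : ℕ} [hq : Fact q.Prime]

/-- Product rule with exact exponents: the exponent of `f·g` is `v_q(f(x)g(x))` (`f(x), g(x) ≠ 0`).
[cite: Zudilin2004, §7 Lemmas 17–18 (proof: Leibniz rule for R^{(j)}/j!)] -/
theorem isDOrdDiv_mul_exact {N : ℕ} {f g : ℚ → ℚ} {x : ℚ} (hf : IsDOrdDiv q (padicValRat q (f x)) N f x)
    (hg : IsDOrdDiv q (padicValRat q (g x)) N g x) (hf0 : f x ≠ 0) (hg0 : g x ≠ 0) :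
    IsDOrdDiv q (padicValRat q (f x * g x)) N (fun t => f t * g t) x := by
  rw [padicValRat.mul hf0 hg0]; exact hf.mul hg

/-- Powers with exact exponents. [cite: Zudilin2004, §7 Lemmas 17–18 (proof: Leibniz rule for R^{(j)}/j!)] -/
theorem isDOrdDiv_pow_exact {N : ℕ} {f : ℚ → ℚ} {x : ℚ} (hf : IsDOrdDiv q (padicValRat q (f x)) N f x) (n : ℕ) :
    IsDOrdDiv q (padicValRat q (f x ^ n)) N (fun t => f t ^ n) x := by
  rw [padicValRat.pow]; exact hf.pow n

/-- Finite products with exact exponents (all values non-zero). [cite: Zudilin2004, §7 Lemmas 17–18 (proof: Leibniz rule for R^{(j)}/j!)] -/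
theorem isDOrdDiv_prod_exact {N : ℕ} {ι : Type*} (S : Finset ι) {F : ι → ℚ → ℚ} {x : ℚ}
    (h : ∀ i ∈ S, IsDOrdDiv q (padicValRat q (F i x)) N (F i) x) (h0 : ∀ i ∈ S, F i x ≠ 0) :
    IsDOrdDiv q (padicValRat q (∏ i ∈ S, F i x)) N (fun t => ∏ i ∈ S, F i t) x := by
  classical
  induction S using Finset.induction_on with
  | empty => simpa using IsDOrdDiv.one (p := q) N x
  | insert a S ha ih =>
    have hS : ∀ i ∈ S, IsDOrdDiv q (padicValRat q (F i x)) N (F i) x := fun i hi => h i (mem_insert_of_mem hi)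
    have hS0 : ∀ i ∈ S, F i x ≠ 0 := fun i hi => h0 i (mem_insert_of_mem hi)
    have hmul := isDOrdDiv_mul_exact (g := fun t => ∏ i ∈ S, F i t) (h a (mem_insert_self a S)) (ih hS hS0)
      (h0 a (mem_insert_self a S)) (prod_ne_zero_iff.2 hS0)
    simpa only [prod_insert ha] using hmul

omit hq in
/-- A non-zero constant, exact exponent. [cite: Zudilin2004, §7 Lemmas 17–18 (proof)] -/
theorem isDOrdDiv_const_exact (N : ℕ) (x : ℚ) (c : ℚ) : IsDOrdDiv q (padicValRat q c) N (fun _ => c) x :=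
  IsDOrdDiv.const N x (PadicOrdGe.of_eq le_rfl)

omit hq in
/-- A linear factor `t + c` whose value `x + c ≠ 0` has `v_q(x+c) ≤ 1`: exact exponent `v_q(x+c)` (the derivative `1`
has order `0 ≥ v_q(x+c) − 1`). [cite: Zudilin2004, §7 Lemma 17 (proof)] -/
theorem isDOrdDiv_add_const_exact {c x : ℚ} (hv : padicValRat q (x + c) ≤ 1) (N : ℕ) :
    IsDOrdDiv q (padicValRat q (x + c)) N (fun t : ℚ => t + c) x := by
  have h := isDOrdDiv_affine q (a := 1) (c := c) (x := x) (e := padicValRat q (x + c)) hv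
    (by rw [one_mul]; exact PadicOrdGe.of_eq le_rfl) (by simpa using PadicOrdGe.of_int (p := q) 1) N
  exact h.congr (Eventually.of_forall fun t => by simp)

/-- An inverse factor `(t + c)^{−1}` whose value is the reciprocal of a non-zero integer `z = x + c` with `v_q(z) ≤ 1`:
exact exponent `v_q((x+c)^{−1}) = −v_q(z)`. [cite: Zudilin2004, §7 Lemma 18 (proof)] -/
theorem isDOrdDiv_inv_add_const_exact {c x : ℚ} (z : ℤ) (hz : x + c = z) (hz0 : z ≠ 0)
    (hv : padicValInt q z ≤ 1) (N : ℕ) :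
    IsDOrdDiv q (padicValRat q ((x + c)⁻¹)) N (fun t : ℚ => (t + c)⁻¹) x := by
  have h := isDOrdDiv_inv_add_const q z hz hz0 hv N
  have e : (if (q : ℤ) ∣ z then (-1 : ℤ) else 0) = padicValRat q ((x + c)⁻¹) := by
    rw [hz, padicValRat.inv, padicValRat.of_int]
    split_ifs with hdvd
    · have h1 : (1 : ℕ) ≤ padicValInt q z :=
        ((padicValInt_dvd_iff 1 z).1 (by simpa using hdvd)).resolve_left hz0
      have : padicValInt q z = 1 := le_antisymm hv h1
      rw [this]; rfl
    · rw [padicValInt.eq_zero_of_not_dvd hdvd]; rfl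
  rwa [e] at h

end Exact

/-! ## §1. The arithmetic factor `Φ_n` (def_Phi) -/

/-- The primes of `Φ_n`: `q` prime, `q ≤ n`, `√(10n) < q` (`10n < q²`) and `{n/q} > ½` (`2·(n mod q) > q`).
[cite: Lai2025TwoAdicZeta, Lemma 4.3 (def_Phi)] -/
def phiPrimes (n : ℕ) : Finset ℕ :=
  (range (n + 1)).filter fun q => q.Prime ∧ 10 * n < q * q ∧ q < 2 * (n % q)

/-- **`Φ_n := ∏_{√(10n) < q ≤ n, {n/q} > ½} q`** (def_Phi). [cite: Lai2025TwoAdicZeta, Lemma 4.3 (def_Phi)] -/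
def PhiL (n : ℕ) : ℕ := ∏ q ∈ phiPrimes n, q

/-- Membership in `phiPrimes n`. [cite: Lai2025TwoAdicZeta, Lemma 4.3 (def_Phi)] -/
theorem mem_phiPrimes {n q : ℕ} :
    q ∈ phiPrimes n ↔ q ≤ n ∧ q.Prime ∧ 10 * n < q * q ∧ q < 2 * (n % q) := by
  rw [phiPrimes, mem_filter, mem_range, Nat.lt_succ_iff]

/-- `Φ_n > 0`. [cite: Lai2025TwoAdicZeta, Lemma 4.3 (def_Phi)] -/
theorem PhiL_pos (n : ℕ) : 0 < PhiL n :=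
  prod_pos fun _ hq => (mem_phiPrimes.1 hq).2.1.pos

/-- `Φ_n ≠ 0` in `ℚ`. [cite: Lai2025TwoAdicZeta, Lemma 4.3 (def_Phi)] -/
theorem PhiL_cast_ne_zero (n : ℕ) : (PhiL n : ℚ) ≠ 0 := by exact_mod_cast (PhiL_pos n).ne'

/-- `v_q(Φ_n) = 1` for `q ∈ phiPrimes n` (a product of distinct primes). [cite: Lai2025TwoAdicZeta, Lemma 4.3 (def_Phi), Lemma 6.2 (proof: "Obviously v₂(Φ_n) = 0")] -/
theorem padicValNat_PhiL_of_mem {n q : ℕ} [hq : Fact q.Prime] (h : q ∈ phiPrimes n) : padicValNat q (PhiL n) = 1 := by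
  classical
  rw [PhiL, ← mul_prod_erase _ _ h, padicValNat.mul hq.out.ne_zero
    (prod_ne_zero_iff.2 fun r hr => (mem_phiPrimes.1 (mem_of_mem_erase hr)).2.1.ne_zero), padicValNat.self hq.out.one_lt]
  have h0 : padicValNat q (∏ r ∈ (phiPrimes n).erase q, r) = 0 := by
    refine padicValNat.eq_zero_of_not_dvd fun hdvd => ?_
    obtain ⟨r, hr, hqr⟩ := (Prime.dvd_finsetProd_iff hq.out.prime _).1 hdvd
    have hrp : r.Prime := (mem_phiPrimes.1 (mem_of_mem_erase hr)).2.1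
    have := (Nat.prime_dvd_prime_iff_eq hq.out hrp).1 hqr
    exact (mem_erase.1 hr).1 this.symm
  rw [h0]

/-- `v_q(Φ_n) = 0` for a prime `q ∉ phiPrimes n`. [cite: Lai2025TwoAdicZeta, Lemma 4.3 (def_Phi)] -/
theorem padicValNat_PhiL_of_not_mem {n q : ℕ} [hq : Fact q.Prime] (h : q ∉ phiPrimes n) :
    padicValNat q (PhiL n) = 0 := by
  refine padicValNat.eq_zero_of_not_dvd fun hdvd => ?_
  obtain ⟨r, hr, hqr⟩ := (Prime.dvd_finsetProd_iff hq.out.prime _).1 hdvd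
  have hrp : r.Prime := (mem_phiPrimes.1 hr).2.1
  have := (Nat.prime_dvd_prime_iff_eq hq.out hrp).1 hqr
  exact h (this ▸ hr)

/-- For `q ∈ phiPrimes n`: `q ≤ n < q²`, so `v_q(d_n) = 1` (tree `Zudilin2004.padicValNat_lcmUpto_eq_one`).
[cite: Lai2025TwoAdicZeta, Lemma 4.3 (proof: "√(10n) < q ≤ n"), Lemma 6.2 (proof: "v₂(d_n) = m−1")] -/
theorem padicValNat_lcmUpto_of_mem_phiPrimes {n q : ℕ} [hq : Fact q.Prime] (h : q ∈ phiPrimes n) :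
    padicValNat q (Nat.lcmUpto n) = 1 := by
  have h' := mem_phiPrimes.1 h
  exact Zudilin2004.padicValNat_lcmUpto_eq_one h'.1 (by nlinarith [h'.2.2.1])

/-- `2 ∉ phiPrimes n` (`10n < 4` forces `n = 0`, and then `2 ≰ 0`): `Φ_n` is odd.
[cite: Lai2025TwoAdicZeta, Lemma 6.2 (proof: "Obviously v₂(Φ_n) = 0")] -/
theorem two_not_mem_phiPrimes (n : ℕ) : 2 ∉ phiPrimes n := by
  intro h
  have h' := mem_phiPrimes.1 h
  omega

/-- `v₂(Φ_n) = 0`. [cite: Lai2025TwoAdicZeta, Lemma 6.2 (proof: "Obviously v₂(Φ_n) = 0")] -/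
theorem padicValNat_two_PhiL (n : ℕ) : padicValNat 2 (PhiL n) = 0 :=
  padicValNat_PhiL_of_not_mem (two_not_mem_phiPrimes n)

/-- A prime of `Φ_n` is odd and satisfies `4n + 3 < q²`, `n < q²`. [cite: Lai2025TwoAdicZeta, Lemma 4.3 (proof: "Since q > √(10n)")] -/
theorem phiPrimes_bounds {n q : ℕ} (h : q ∈ phiPrimes n) : 3 ≤ q ∧ 4 * n < q * q ∧ n < q * q ∧ 1 ≤ n := by
  have h' := mem_phiPrimes.1 h
  have h2 := h'.2.1.two_le
  have hq2 : q ≠ 2 := fun e => two_not_mem_phiPrimes n (e ▸ h)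
  refine ⟨by omega, by nlinarith, by nlinarith, ?_⟩
  by_contra h0
  have : n = 0 := by omega
  subst this
  simp at h'


/-! ## §2. The `q`-adic orders of the bricks of `Ψ_n = (t+k)^{2s+4}A_n(t)` at `t = −k` (`q` odd, `q² ≥ 4n`)

Each linear factor `t + a/4 + j` of `F_{a/4}` has at `−k` the value `(4(j−k)+a)/4`, an odd-denominator rational with
numerator `0 < |4(j−k)+a| < 4n ≤ q²`, so `v_q ≤ 1`; each inverse factor `(t+l)^{−1}` of `(t+k)G` has value `(l−k)^{−1}`,
`0 < |l−k| ≤ n < q²`.  Hence the divided derivatives lose at most one `q` each («`v_q(U^{(v)}(−k)) ≥ −1−v`»). -/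

section Bricks

variable {q : ℕ} [hq : Fact q.Prime]

/-- The value `−k + (a/4 + j) = (4(j−k)+a)/4`. [cite: Lai2025TwoAdicZeta, Lemma 4.3 (proof: (U^(v)), the terms (t+ℓ+1/4)^{−1−v}, (t+ℓ+3/4)^{−1−v})] -/
theorem neg_add_quarter_eq (a : ℤ) (j k : ℕ) :
    (-(k : ℚ)) + ((a : ℚ) / 4 + j) = (((4 * ((j : ℤ) - k) + a : ℤ)) : ℚ) / 4 := by
  push_cast; ring

/-- For `q` odd and `z ∈ ℤ`: `v_q(z/4) = v_q(z)`. [cite: Lai2025TwoAdicZeta, Lemma 4.3 (proof: "Since q > √(10n), we can see from (U^(v)) that v_q(U^{(v)}(−k)) ≥ −1−v")] -/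
theorem padicValRat_div_four (hq3 : 3 ≤ q) {z : ℤ} (hz : z ≠ 0) :
    padicValRat q ((z : ℚ) / 4) = padicValInt q z := by
  have h4 : padicValRat q (4 : ℚ) = 0 := by
    have h : padicValNat q 4 = 0 := by
      refine padicValNat.eq_zero_of_not_dvd fun hdvd => ?_
      have hle : q ≤ 4 := Nat.le_of_dvd (by norm_num) hdvd
      interval_cases q
      · exact absurd hdvd (by norm_num)
      · exact absurd hq.out (by norm_num)
    have := padicValRat.of_nat (p := q) (n := 4)
    rw [h] at this
    exact_mod_cast this
  rw [padicValRat.div (by exact_mod_cast hz) (by norm_num), h4, sub_zero, padicValRat.of_int]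

/-- **The quarter brick `F_{a/4} = 2^{3n}(t+a/4)_n/n!` (`a ∈ {1,2,3}`) at `−k`** (`k ≤ n`, `q` odd, `4n ≤ q²`): exact
divided-derivative orders `v_q(𝒟_jF_{a/4}(−k)) ≥ v_q(F_{a/4}(−k)) − j`.
[cite: Lai2025TwoAdicZeta, Lemma 4.3 (proof: induction step (aaa)–(ddd) for the factors of (t+¼)_n, (t+¾)_n)] -/
theorem isDOrdDiv_quarterBrick_exact (hq3 : 3 ≤ q) {a : ℤ} (ha0 : 0 < a) (ha4 : a < 4) {n k : ℕ}
    (h4n : 4 * n ≤ q * q) (hk : k ≤ n) (N : ℕ) :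
    IsDOrdDiv q (padicValRat q (quarterBrick a n (-(k : ℚ)))) N (quarterBrick a n) (-(k : ℚ)) := by
  have hfac : ∀ j ∈ range n, IsDOrdDiv q (padicValRat q ((-(k : ℚ)) + ((a : ℚ) / 4 + j))) N
      (fun t : ℚ => t + ((a : ℚ) / 4 + j)) (-(k : ℚ)) := by
    intro j hj
    have hj' := mem_range.1 hj
    refine isDOrdDiv_add_const_exact ?_ N
    have hz : (4 * ((j : ℤ) - k) + a : ℤ) ≠ 0 := by omega
    rw [neg_add_quarter_eq, padicValRat_div_four hq3 hz]
    have habs : |(4 * ((j : ℤ) - k) + a : ℤ)| < (q : ℤ) ^ 2 := by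
      have : ((q * q : ℕ) : ℤ) = (q : ℤ) ^ 2 := by push_cast; ring
      rw [abs_lt, ← this]
      constructor <;> push_cast <;> omega
    exact_mod_cast padicValInt_le_one_of_abs_lt_sq q hz habs
  have hfac0 : ∀ j ∈ range n, (-(k : ℚ)) + ((a : ℚ) / 4 + j) ≠ 0 := by
    intro j _
    rw [neg_add_quarter_eq]
    have hz : (4 * ((j : ℤ) - k) + a : ℤ) ≠ 0 := by omega
    exact div_ne_zero (by exact_mod_cast hz) (by norm_num)
  have hprod := isDOrdDiv_prod_exact (range n) (F := fun (j : ℕ) (t : ℚ) => t + ((a : ℚ) / 4 + j)) hfac hfac0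
  have hc := isDOrdDiv_const_exact (q := q) N (-(k : ℚ)) ((2 : ℚ) ^ (3 * n) / (n ! : ℚ))
  have hc0 : (2 : ℚ) ^ (3 * n) / (n ! : ℚ) ≠ 0 :=
    div_ne_zero (pow_ne_zero _ two_ne_zero) (by exact_mod_cast Nat.factorial_ne_zero n)
  have key := isDOrdDiv_mul_exact (f := fun _ : ℚ => (2 : ℚ) ^ (3 * n) / (n ! : ℚ))
    (g := fun t : ℚ => ∏ j ∈ range n, (t + ((a : ℚ) / 4 + j))) hc hprod hc0 (prod_ne_zero_iff.2 hfac0)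
  have e1 : (fun t : ℚ => (fun _ : ℚ => (2 : ℚ) ^ (3 * n) / (n ! : ℚ)) t *
      (fun t : ℚ => ∏ j ∈ range n, (t + ((a : ℚ) / 4 + j))) t) = quarterBrick a n := by
    funext t; rw [quarterBrick]
  have e2 : (fun _ : ℚ => (2 : ℚ) ^ (3 * n) / (n ! : ℚ)) (-(k : ℚ)) *
      (fun t : ℚ => ∏ j ∈ range n, (t + ((a : ℚ) / 4 + j))) (-(k : ℚ)) = quarterBrick a n (-(k : ℚ)) := by
    rw [quarterBrick]
  rw [e1, e2] at key
  exact key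

/-- `F_{a/4}(−k) ≠ 0` (`a ∈ {1,2,3}`). [cite: Lai2025TwoAdicZeta, Lemma 4.3 (proof: a_{n,2s+4,k} ≠ 0)] -/
theorem quarterBrick_neg_ne_zero {a : ℤ} (ha0 : 0 < a) (ha4 : a < 4) (n k : ℕ) :
    quarterBrick a n (-(k : ℚ)) ≠ 0 := by
  rw [quarterBrick]
  refine mul_ne_zero (div_ne_zero (pow_ne_zero _ two_ne_zero) (by exact_mod_cast Nat.factorial_ne_zero n))
    (prod_ne_zero_iff.2 fun j _ => ?_)
  rw [neg_add_quarter_eq]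
  have hz : (4 * ((j : ℤ) - k) + a : ℤ) ≠ 0 := by omega
  exact div_ne_zero (by exact_mod_cast hz) (by norm_num)

/-- `((t+k)G)(−k) ≠ 0`. [cite: Lai2025TwoAdicZeta, Lemma 4.3 (proof: a_{n,2s+4,k} ≠ 0)] -/
theorem Greg_neg_ne_zero {n k : ℕ} (hk : k ≤ n) : Greg n k (-(k : ℚ)) ≠ 0 := by
  rw [Greg_neg n hk]
  exact div_ne_zero (mul_ne_zero (pow_ne_zero _ (by norm_num)) (by exact_mod_cast Nat.factorial_ne_zero n))
    (mul_ne_zero (by exact_mod_cast Nat.factorial_ne_zero k) (by exact_mod_cast Nat.factorial_ne_zero (n - k)))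

/-- **The brick `(t+k)G(t) = n!·∏_{l ≤ n, l ≠ k}(t+l)^{−1}` at `−k`** (`k ≤ n < q²`): exact divided-derivative orders.
[cite: Lai2025TwoAdicZeta, Lemma 4.3 (proof: induction step (aaa)–(ddd) for the factors (t+ℓ)^{−1}, ℓ ≠ k)] -/
theorem isDOrdDiv_Greg_exact {n k : ℕ} (hn : n < q * q) (hk : k ≤ n) (N : ℕ) :
    IsDOrdDiv q (padicValRat q (Greg n k (-(k : ℚ)))) N (Greg n k) (-(k : ℚ)) := by
  set S := (range (n + 1)).filter (fun l => l ≠ k) with hS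
  have hfac : ∀ l ∈ S, IsDOrdDiv q (padicValRat q (((-(k : ℚ)) + (l : ℚ))⁻¹)) N
      (fun t : ℚ => (t + (l : ℚ))⁻¹) (-(k : ℚ)) := by
    intro l hl
    have hl' := mem_filter.1 hl
    have hln : l ≤ n := by have := mem_range.1 hl'.1; omega
    have hz : ((l : ℤ) - k : ℤ) ≠ 0 := sub_ne_zero.2 (by exact_mod_cast hl'.2)
    refine isDOrdDiv_inv_add_const_exact ((l : ℤ) - k) (by push_cast; ring) hz ?_ N
    refine padicValInt_le_one_of_abs_lt_sq q hz ?_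
    have : ((q * q : ℕ) : ℤ) = (q : ℤ) ^ 2 := by push_cast; ring
    rw [abs_lt, ← this]
    constructor <;> push_cast <;> omega
  have hfac0 : ∀ l ∈ S, ((-(k : ℚ)) + (l : ℚ))⁻¹ ≠ 0 := by
    intro l hl
    have hl' := mem_filter.1 hl
    refine inv_ne_zero ?_
    rw [show (-(k : ℚ) + l) = (((l : ℤ) - k : ℤ) : ℚ) by push_cast; ring]
    exact_mod_cast sub_ne_zero.2 (by exact_mod_cast hl'.2 : (l : ℤ) ≠ k)
  have hprod := isDOrdDiv_prod_exact S (F := fun (l : ℕ) (t : ℚ) => (t + (l : ℚ))⁻¹) hfac hfac0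
  have hc := isDOrdDiv_const_exact (q := q) N (-(k : ℚ)) (n ! : ℚ)
  have h := isDOrdDiv_mul_exact (f := fun _ : ℚ => (n ! : ℚ)) (g := fun t : ℚ => ∏ l ∈ S, (t + (l : ℚ))⁻¹) hc hprod
    (by exact_mod_cast Nat.factorial_ne_zero n) (prod_ne_zero_iff.2 hfac0)
  have e1 : (fun t : ℚ => (fun _ : ℚ => (n ! : ℚ)) t * (fun t : ℚ => ∏ l ∈ S, (t + (l : ℚ))⁻¹) t) = Greg n k := by
    funext t; rw [Greg_eq n hk t]
  have e2 : (fun _ : ℚ => (n ! : ℚ)) (-(k : ℚ)) * (fun t : ℚ => ∏ l ∈ S, (t + (l : ℚ))⁻¹) (-(k : ℚ)) =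
      Greg n k (-(k : ℚ)) := by
    rw [Greg_eq n hk]
  rw [e1, e2] at h
  exact h

/-- `Q_k(−k) ≠ 0`. [cite: Lai2025TwoAdicZeta, Lemma 4.3 (proof: a_{n,2s+4,k} = Ψ_n(−k), j = 0)] -/
theorem Qk_neg_ne_zero {n k : ℕ} (hk : k ≤ n) : Qk n k (-(k : ℚ)) ≠ 0 := by
  rw [Qk, Pk]
  exact mul_ne_zero (mul_ne_zero (quarterBrick_neg_ne_zero one_pos (by norm_num) n k)
    (mul_ne_zero (quarterBrick_neg_ne_zero (by norm_num) (by norm_num) n k) (Greg_neg_ne_zero hk)))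
    (Greg_neg_ne_zero hk)

/-- **`Q_k = F_{1/4}F_{3/4}((t+k)G)²` at `−k`**: `v_q(𝒟_jQ_k(−k)) ≥ v_q(Q_k(−k)) − j` for all `j` (`q` odd, `4n ≤ q²`, `k ≤ n`).
[cite: Lai2025TwoAdicZeta, Lemma 4.3 (proof: (aaa)–(ddd))] -/
theorem isDOrdDiv_Qk_exact (hq3 : 3 ≤ q) {n k : ℕ} (h4n : 4 * n ≤ q * q) (hk : k ≤ n) (N : ℕ) :
    IsDOrdDiv q (padicValRat q (Qk n k (-(k : ℚ)))) N (Qk n k) (-(k : ℚ)) := by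
  have hn : n < q * q := by
    rcases Nat.eq_zero_or_pos n with rfl | hn0
    · exact Nat.mul_pos (by omega) (by omega)
    · omega
  have h1 := isDOrdDiv_quarterBrick_exact hq3 (a := 1) one_pos (by norm_num) h4n hk N
  have h3 := isDOrdDiv_quarterBrick_exact hq3 (a := 3) (by norm_num) (by norm_num) h4n hk N
  have hG := isDOrdDiv_Greg_exact hn hk N
  have h30 : quarterBrick 3 n (-(k : ℚ)) ≠ 0 := quarterBrick_neg_ne_zero (by norm_num) (by norm_num) n k
  have h10 : quarterBrick 1 n (-(k : ℚ)) ≠ 0 := quarterBrick_neg_ne_zero one_pos (by norm_num) n k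
  have hG0 : Greg n k (-(k : ℚ)) ≠ 0 := Greg_neg_ne_zero hk
  have hP := isDOrdDiv_mul_exact (f := quarterBrick 3 n) (g := Greg n k) h3 hG h30 hG0
  have hQ1 := isDOrdDiv_mul_exact (f := quarterBrick 1 n) (g := fun t => quarterBrick 3 n t * Greg n k t) h1 hP h10
    (mul_ne_zero h30 hG0)
  have hQ := isDOrdDiv_mul_exact (f := fun t => quarterBrick 1 n t * (quarterBrick 3 n t * Greg n k t)) (g := Greg n k)
    hQ1 hG (mul_ne_zero h10 (mul_ne_zero h30 hG0)) hG0
  have e1 : (fun t => quarterBrick 1 n t * (quarterBrick 3 n t * Greg n k t) * Greg n k t) = Qk n k := by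
    funext t; rw [Qk, Pk]
  have e2 : quarterBrick 1 n (-(k : ℚ)) * (quarterBrick 3 n (-(k : ℚ)) * Greg n k (-(k : ℚ))) * Greg n k (-(k : ℚ)) =
      Qk n k (-(k : ℚ)) := by rw [Qk, Pk]
  rw [e1, e2] at hQ
  exact hQ

/-- **(asser) in divided-derivative form:** `v_q(𝒟_jΨ_n(−k)) ≥ (s+2)·v_q(Q_k(−k)) − j` for `Ψ_n = Q_k^{s+2}(4t+2n)^δ`
(`q` odd, `4n ≤ q²`, `k ≤ n`; the integer polynomial `4t+2n` costs nothing — no parity condition on `n`).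
[cite: Lai2025TwoAdicZeta, Lemma 4.3 (proof: (asser), (ddd)), Remark 4.4] -/
theorem isDOrdDiv_AsReg (hq3 : 3 ≤ q) (s δ : ℕ) {n k : ℕ} (h4n : 4 * n ≤ q * q) (hk : k ≤ n) (N : ℕ) :
    IsDOrdDiv q (((s + 2 : ℕ) : ℤ) * padicValRat q (Qk n k (-(k : ℚ)))) N (AsReg s δ n k) (-(k : ℚ)) := by
  have hQ := (isDOrdDiv_Qk_exact hq3 h4n hk N).pow (s + 2)
  have hL : IsDOrdDiv q 0 N (fun t : ℚ => 4 * t + 2 * n) (-(k : ℚ)) := by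
    refine isDOrdDiv_affine q (e := 0) zero_le_one ?_ (by simpa using PadicOrdGe.of_nat (p := q) 4) N
    have := PadicOrdGe.of_int (p := q) (4 * (-(k : ℤ)) + 2 * n)
    push_cast at this
    exact this
  have h := hQ.mul (hL.pow δ)
  refine (h.mono (le_of_eq ?_)).congr (Eventually.of_forall fun t => by rw [AsReg])
  push_cast; ring

end Bricks

/-! ## §3. The `j = 0` display: `Q_k(−k) = (4k)!(4(n−k))!/((2k)!(2(n−k))!k!²(n−k)!²)`, a product of central binomials -/

/-- `∏_{m<M}(4m+1)(4m+3)` (the odd numbers below `4M`). [cite: Lai2025TwoAdicZeta, Lemma 4.3 (proof: (−k+¼)_n(−k+¾)_n)] -/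
def oddProd (M : ℕ) : ℕ := ∏ m ∈ range M, ((4 * m + 1) * (4 * m + 3))

/-- `∏_{m<M}(4m+1)(4m+3) · 4^M · (2M)! = (4M)!`. [cite: Lai2025TwoAdicZeta, Lemma 4.3 (proof: 2^{(6s+12)n}(−k+¼)_n(−k+¾)_n = (4k)!(4n−4k)!/((2k)!(2n−2k)!))] -/
theorem oddProd_mul (M : ℕ) : oddProd M * (4 ^ M * (2 * M)!) = (4 * M)! := by
  induction M with
  | zero => simp [oddProd]
  | succ M ih =>
    have e : (4 * (M + 1))! = (4 * M + 4) * ((4 * M + 3) * ((4 * M + 2) * ((4 * M + 1) * (4 * M)!))) := by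
      rw [show 4 * (M + 1) = (4 * M + 3) + 1 by ring, Nat.factorial_succ,
        show 4 * M + 3 = (4 * M + 2) + 1 by ring, Nat.factorial_succ,
        show 4 * M + 2 = (4 * M + 1) + 1 by ring, Nat.factorial_succ, Nat.factorial_succ (4 * M)]
    have e2 : (2 * (M + 1))! = (2 * M + 2) * ((2 * M + 1) * (2 * M)!) := by
      rw [show 2 * (M + 1) = (2 * M + 1) + 1 by ring, Nat.factorial_succ, Nat.factorial_succ (2 * M)]
    rw [e, e2, oddProd, prod_range_succ, ← oddProd, pow_succ, ← ih]
    ring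

/-- `oddProd M = (4M)!/(4^M(2M)!)` in `ℚ`. [cite: Lai2025TwoAdicZeta, Lemma 4.3 (proof)] -/
theorem oddProd_cast (M : ℕ) : (oddProd M : ℚ) = ((4 * M)! : ℚ) / ((4 : ℚ) ^ M * ((2 * M)! : ℚ)) := by
  rw [eq_div_iff (by positivity), ← Nat.cast_ofNat, ← Nat.cast_pow, ← Nat.cast_mul, ← Nat.cast_mul, oddProd_mul]

/-- `∏_{j<n}(4(j−k)+1)(4(j−k)+3) = oddProd k · oddProd (n−k)` (`k ≤ n`; the `k` negative pairs reflect to the odd numbers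
below `4k`, the rest are the odd numbers below `4(n−k)`). [cite: Lai2025TwoAdicZeta, Lemma 4.3 (proof: (−k+¼)_n(−k+¾)_n via (4k)!, (4n−4k)!)] -/
theorem prod_quarter_pairs (n : ℕ) {k : ℕ} (hk : k ≤ n) :
    ∏ j ∈ range n, ((4 * ((j : ℚ) - k) + 1) * (4 * ((j : ℚ) - k) + 3)) = (oddProd k : ℚ) * (oddProd (n - k) : ℚ) := by
  rw [← prod_range_mul_prod_Ico _ hk]
  congr 1
  · rw [oddProd, Nat.cast_prod, ← prod_range_reflect (fun m : ℕ => (((4 * m + 1) * (4 * m + 3) : ℕ) : ℚ)) k]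
    refine prod_congr rfl fun j hj => ?_
    have hj' := mem_range.1 hj
    have e1 : ((k - 1 - j : ℕ) : ℚ) = (k : ℚ) - 1 - j := by
      rw [Nat.cast_sub (by omega : j ≤ k - 1), Nat.cast_sub (by omega : 1 ≤ k)]; push_cast; ring
    push_cast
    rw [e1]; ring
  · rw [oddProd, Nat.cast_prod, prod_Ico_eq_prod_range]
    refine prod_congr rfl fun m _ => ?_
    push_cast; ring

/-- **`F_{1/4}(−k)·F_{3/4}(−k) = (4k)!(4(n−k))!/(n!²(2k)!(2(n−k))!)`** (`k ≤ n`).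
[cite: Lai2025TwoAdicZeta, Lemma 4.3 (proof: "= (−4k+2n)^δ((4k)!(4n−4k)!/((2k)!(2n−2k)!k!²(n−k)!²))^{s+2}")] -/
theorem quarterBrick_one_mul_three_neg (n : ℕ) {k : ℕ} (hk : k ≤ n) :
    quarterBrick 1 n (-(k : ℚ)) * quarterBrick 3 n (-(k : ℚ)) =
      ((4 * k)! : ℚ) * ((4 * (n - k))! : ℚ) / ((n ! : ℚ) ^ 2 * ((2 * k)! : ℚ) * ((2 * (n - k))! : ℚ)) := by
  have hpair : (∏ j ∈ range n, ((-(k : ℚ)) + ((((1 : ℤ) : ℚ)) / 4 + j))) *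
      (∏ j ∈ range n, ((-(k : ℚ)) + ((((3 : ℤ) : ℚ)) / 4 + j))) =
      (oddProd k : ℚ) * (oddProd (n - k) : ℚ) / (16 : ℚ) ^ n := by
    rw [← prod_quarter_pairs n hk, ← prod_mul_distrib, eq_div_iff (by positivity),
      show (16 : ℚ) ^ n = ∏ _j ∈ range n, (16 : ℚ) by rw [prod_const, card_range], ← prod_mul_distrib]
    refine prod_congr rfl fun j _ => ?_
    push_cast; ring
  have hn : (n ! : ℚ) ≠ 0 := by exact_mod_cast Nat.factorial_ne_zero n
  have h2k : ((2 * k)! : ℚ) ≠ 0 := by exact_mod_cast Nat.factorial_ne_zero _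
  have h2k' : ((2 * (n - k))! : ℚ) ≠ 0 := by exact_mod_cast Nat.factorial_ne_zero _
  calc quarterBrick 1 n (-(k : ℚ)) * quarterBrick 3 n (-(k : ℚ))
      = ((2 : ℚ) ^ (3 * n) / (n ! : ℚ)) ^ 2 * ((∏ j ∈ range n, ((-(k : ℚ)) + ((((1 : ℤ) : ℚ)) / 4 + j))) *
          (∏ j ∈ range n, ((-(k : ℚ)) + ((((3 : ℤ) : ℚ)) / 4 + j)))) := by
        rw [quarterBrick, quarterBrick]; ring
    _ = ((2 : ℚ) ^ (3 * n) / (n ! : ℚ)) ^ 2 * ((oddProd k : ℚ) * (oddProd (n - k) : ℚ) / (16 : ℚ) ^ n) := by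
        rw [hpair]
    _ = _ := by
        rw [oddProd_cast, oddProd_cast, show (16 : ℚ) ^ n = ((2 : ℚ) ^ (3 * n)) ^ 2 / ((4 : ℚ) ^ k * 4 ^ (n - k)) by
          rw [← pow_add, Nat.add_sub_cancel' hk, ← pow_mul, show (16 : ℚ) = 2 ^ 6 / 4 by norm_num, div_pow,
            ← pow_mul]; ring_nf]
        field_simp

/-- The product of central binomials `binom(4k,2k)binom(2k,k)·binom(4k',2k')binom(2k',k')` (`k' = n − k`).
[cite: Lai2025TwoAdicZeta, Lemma 4.3 (proof: the ratio (4k)!(4n−4k)!/((2k)!(2n−2k)!k!²(n−k)!²))] -/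
def qkNat (n k : ℕ) : ℕ :=
  ((4 * k).choose (2 * k) * (2 * k).choose k) * ((4 * (n - k)).choose (2 * (n - k)) * (2 * (n - k)).choose (n - k))

/-- `binom(4M,2M)·binom(2M,M) = (4M)!/((2M)!·M!²)` in `ℚ`. [cite: Lai2025TwoAdicZeta, Lemma 4.3 (proof)] -/
theorem choose_mul_choose_cast (M : ℕ) :
    (((4 * M).choose (2 * M) * (2 * M).choose M : ℕ) : ℚ) = ((4 * M)! : ℚ) / (((2 * M)! : ℚ) * (M ! : ℚ) ^ 2) := by
  have h1 := (Nat.choose_mul_factorial_mul_factorial (by omega : 2 * M ≤ 4 * M))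
  have h2 := (Nat.choose_mul_factorial_mul_factorial (by omega : M ≤ 2 * M))
  rw [show 4 * M - 2 * M = 2 * M by omega] at h1
  rw [show 2 * M - M = M by omega] at h2
  have hM : (M ! : ℚ) ≠ 0 := by exact_mod_cast Nat.factorial_ne_zero M
  have h2M : ((2 * M)! : ℚ) ≠ 0 := by exact_mod_cast Nat.factorial_ne_zero _
  rw [eq_div_iff (by positivity)]
  have h1' : (((4 * M).choose (2 * M) : ℕ) : ℚ) * ((2 * M)! : ℚ) * ((2 * M)! : ℚ) = ((4 * M)! : ℚ) := by
    exact_mod_cast h1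
  have h2' : (((2 * M).choose M : ℕ) : ℚ) * (M ! : ℚ) * (M ! : ℚ) = ((2 * M)! : ℚ) := by exact_mod_cast h2
  push_cast
  rw [show (((4 * M).choose (2 * M) : ℕ) : ℚ) * (((2 * M).choose M : ℕ) : ℚ) * (((2 * M)! : ℚ) * (M ! : ℚ) ^ 2) =
    (((4 * M).choose (2 * M) : ℕ) : ℚ) * ((2 * M)! : ℚ) * ((((2 * M).choose M : ℕ) : ℚ) * (M ! : ℚ) * (M ! : ℚ)) by ring,
    h2', h1']

/-- **The `j = 0` display:** `Q_k(−k) = binom(4k,2k)binom(2k,k)binom(4(n−k),2(n−k))binom(2(n−k),n−k)`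
`= (4k)!(4n−4k)!/((2k)!(2n−2k)!k!²(n−k)!²)` (`k ≤ n`), so that `a_{n,2s+4,k} = (2n−4k)^δ Q_k(−k)^{s+2}` (sibling
`coeffAs_top_eq`). [cite: Lai2025TwoAdicZeta, Lemma 4.3 (proof: "a_{n,2s+4,k} = … = (−4k+2n)^δ((4k)!(4n−4k)!/((2k)!(2n−2k)!k!²(n−k)!²))^{s+2}")] -/
theorem Qk_neg_eq_choose (n : ℕ) {k : ℕ} (hk : k ≤ n) : Qk n k (-(k : ℚ)) = (qkNat n k : ℚ) := by
  have hn : (n ! : ℚ) ≠ 0 := by exact_mod_cast Nat.factorial_ne_zero n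
  have hkf : (k ! : ℚ) ≠ 0 := by exact_mod_cast Nat.factorial_ne_zero k
  have hkf' : ((n - k)! : ℚ) ≠ 0 := by exact_mod_cast Nat.factorial_ne_zero (n - k)
  have h2k : ((2 * k)! : ℚ) ≠ 0 := by exact_mod_cast Nat.factorial_ne_zero _
  have h2k' : ((2 * (n - k))! : ℚ) ≠ 0 := by exact_mod_cast Nat.factorial_ne_zero _
  have hQ : Qk n k (-(k : ℚ)) = (quarterBrick 1 n (-(k : ℚ)) * quarterBrick 3 n (-(k : ℚ))) *
      Greg n k (-(k : ℚ)) ^ 2 := by rw [Qk, Pk]; ring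
  have hG2 : Greg n k (-(k : ℚ)) ^ 2 = (n ! : ℚ) ^ 2 / ((k ! : ℚ) ^ 2 * ((n - k)! : ℚ) ^ 2) := by
    rw [Greg_neg n hk, div_pow, mul_pow, mul_pow, ← pow_mul, show k * 2 = 2 * k by ring, pow_mul, neg_one_sq, one_pow,
      one_mul]
  rw [hQ, hG2, quarterBrick_one_mul_three_neg n hk, qkNat, Nat.cast_mul, choose_mul_choose_cast, choose_mul_choose_cast]
  field_simp

/-! ## §4. The digit count: `v_q(Q_k(−k)) ≥ 1` for the primes of `Φ_n` (Kummer) -/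

section Kummer

variable {q : ℕ} [hq : Fact q.Prime]

/-- Kummer, lowest digit: if `2·(M mod q) ≥ q` then `q ∣ binom(2M, M)`. [cite: Lai2025TwoAdicZeta, Lemma 4.3 (proof: "[4y] + [4x−4y] − [2y] − [2x−2y] − 2[y] − 2[x−y] … is at least 1")] -/
theorem one_le_padicValNat_choose_two_mul {M : ℕ} (h : q ≤ 2 * (M % q)) : 1 ≤ padicValNat q ((2 * M).choose M) := by
  have hq1 := hq.out.one_lt
  have hMq : q ≤ 2 * M := h.trans (Nat.mul_le_mul_left 2 (Nat.mod_le M q))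
  have hlog : 1 ≤ Nat.log q (2 * M) := Nat.le_log_of_pow_le hq1 (by simpa using hMq)
  rw [padicValNat_choose (by omega : M ≤ 2 * M) (Nat.lt_succ_self _), show 2 * M - M = M by omega]
  refine Nat.one_le_iff_ne_zero.2 (card_ne_zero.2 ⟨1, ?_⟩)
  rw [mem_filter, mem_Ico, pow_one]
  exact ⟨⟨le_rfl, by omega⟩, by omega⟩

omit hq in
/-- `(2M) mod q = 2(M mod q)` when `2(M mod q) < q`. [folklore] -/
private theorem two_mul_mod_of_lt {M : ℕ} (h : 2 * (M % q) < q) : (2 * M) % q = 2 * (M % q) := by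
  have hdiv := Nat.div_add_mod M q
  rw [show 2 * M = 2 * (M % q) + q * (2 * (M / q)) by
    conv_lhs => rw [← hdiv]
    ring, Nat.add_mul_mod_self_left, Nat.mod_eq_of_lt h]

/-- `qkNat n k ≠ 0`. [cite: Lai2025TwoAdicZeta, Lemma 4.3 (proof)] -/
theorem qkNat_ne_zero (n k : ℕ) : qkNat n k ≠ 0 := by
  unfold qkNat
  exact mul_ne_zero (mul_ne_zero (Nat.choose_pos (by omega)).ne' (Nat.choose_pos (by omega)).ne')
    (mul_ne_zero (Nat.choose_pos (by omega)).ne' (Nat.choose_pos (by omega)).ne')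

/-- **The digit count:** for `q ∈ phiPrimes n` (so `2(n mod q) > q`) and `k ≤ n`,
`v_q(binom(4k,2k)binom(2k,k)binom(4k',2k')binom(2k',k')) ≥ 1` (`k' = n−k`): with `y = k mod q`, `z = k' mod q`, if none
of `2y, 4y, 2z, 4z` reaches `q` then `n mod q = y + z < q/2` — the printed «`[4y]+[4x−4y]−[2y]−[2x−2y]−2[y]−2[x−y] ≥ 1`
whenever `½ < x < 1`». [cite: Lai2025TwoAdicZeta, Lemma 4.3 (proof, case j = 0)] -/
theorem one_le_padicValNat_qkNat {n k : ℕ} (hmem : q ∈ phiPrimes n) (hk : k ≤ n) : 1 ≤ padicValNat q (qkNat n k) := by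
  have hq' := (mem_phiPrimes.1 hmem).2.2.2
  have hne : ∀ a b : ℕ, (2 * a).choose a ≠ 0 ∧ (4 * b).choose (2 * b) ≠ 0 := fun a b =>
    ⟨(Nat.choose_pos (by omega)).ne', (Nat.choose_pos (by omega)).ne'⟩
  rw [qkNat, padicValNat.mul (mul_ne_zero (hne k k).2 (hne k k).1) (mul_ne_zero (hne (n - k) (n - k)).2
      (hne (n - k) (n - k)).1), padicValNat.mul (hne k k).2 (hne k k).1,
    padicValNat.mul (hne (n - k) (n - k)).2 (hne (n - k) (n - k)).1]
  set y := k % q with hy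
  set z := (n - k) % q with hz
  have hy4 : (4 * k).choose (2 * k) = (2 * (2 * k)).choose (2 * k) := by ring_nf
  have hz4 : (4 * (n - k)).choose (2 * (n - k)) = (2 * (2 * (n - k))).choose (2 * (n - k)) := by ring_nf
  by_cases h1 : q ≤ 2 * y
  · have := one_le_padicValNat_choose_two_mul (q := q) (M := k) h1; omega
  by_cases h2 : q ≤ 2 * ((2 * k) % q)
  · have := one_le_padicValNat_choose_two_mul (q := q) (M := 2 * k) h2; rw [hy4]; omega
  by_cases h3 : q ≤ 2 * z
  · have := one_le_padicValNat_choose_two_mul (q := q) (M := n - k) h3; omega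
  by_cases h4 : q ≤ 2 * ((2 * (n - k)) % q)
  · have := one_le_padicValNat_choose_two_mul (q := q) (M := 2 * (n - k)) h4; rw [hz4]; omega
  exfalso
  push Not at h1 h2 h3 h4
  rw [two_mul_mod_of_lt (q := q) (by omega)] at h2
  rw [two_mul_mod_of_lt (q := q) (by omega)] at h4
  -- `n mod q = y + z`
  have hmod : n % q = y + z := by
    have h := Nat.add_mod k (n - k) q
    rw [Nat.add_sub_cancel' hk] at h
    rw [h, ← hy, ← hz, Nat.mod_eq_of_lt (by omega)]
  omega

end Kummer

/-! ## §5. Lemma 4.3 (strong_ari_a): `Φ_n^{−s−2}d_n^{2s+4−i}a_{n,i,k} ∈ ℤ` -/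

/-- `v_q(Q_k(−k)) ≥ 1` for `q ∈ phiPrimes n`, `k ≤ n`. [cite: Lai2025TwoAdicZeta, Lemma 4.3 (proof, j = 0)] -/
theorem one_le_padicValRat_Qk_neg {n k q : ℕ} [Fact q.Prime] (hmem : q ∈ phiPrimes n) (hk : k ≤ n) :
    1 ≤ padicValRat q (Qk n k (-(k : ℚ))) := by
  rw [Qk_neg_eq_choose n hk, padicValRat.of_nat]
  exact_mod_cast one_le_padicValNat_qkNat hmem hk

/-- **(asser):** for `q ∈ phiPrimes n`, `k ≤ n`, `i ≤ 2s+4`: `v_q(a_{n,i,k}) ≥ i − s − 2`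
(«`v_q(a_{n,2s+4−j,k}) ≥ s+2−j`», here for every `n`, cf. Remark 4.4). [cite: Lai2025TwoAdicZeta, Lemma 4.3 (proof, (asser)), Remark 4.4] -/
theorem padicOrdGe_coeffAs_of_mem_phiPrimes (s δ : ℕ) {n k i q : ℕ} [Fact q.Prime] (hmem : q ∈ phiPrimes n)
    (hk : k ≤ n) (hi : i ≤ 2 * s + 4) : PadicOrdGe q ((i : ℤ) - s - 2) (coeffAs s δ n i k) := by
  have hb := phiPrimes_bounds hmem
  have h := (isDOrdDiv_AsReg (q := q) hb.1 s δ hb.2.1.le hk (2 * s + 4 - i)).padicOrdGe le_rfl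
  rw [coeffAs]
  refine h.mono ?_
  have h1 := one_le_padicValRat_Qk_neg hmem hk
  push_cast [Nat.cast_sub hi]
  nlinarith

/-- **Lemma 4.3 (strong_ari_a):** `Φ_n^{−s−2}·d_n^{2s+4−i}·a_{n,i,k} ∈ ℤ` for every `n`, `k ≤ n` and `i` — at a prime of
`Φ_n`, `v_q(d_n) = 1` and (asser); at any other prime, `v_q(Φ_n) = 0` and Lemma 4.2. [cite: Lai2025TwoAdicZeta, Lemma 4.3 (strong_ari_a)] -/
theorem exists_int_phi_coeffAs (s δ n : ℕ) {k : ℕ} (hk : k ≤ n) (i : ℕ) :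
    ∃ z : ℤ, (Nat.lcmUpto n : ℚ) ^ (2 * s + 4 - i) * coeffAs s δ n i k / (PhiL n : ℚ) ^ (s + 2) = z := by
  refine Rat.exists_int_of_padicOrdGe fun p hp => ?_
  haveI : Fact p.Prime := ⟨hp⟩
  rw [div_eq_mul_inv]
  by_cases hmem : p ∈ phiPrimes n
  · have hb := phiPrimes_bounds hmem
    have hd : PadicOrdGe p ((2 * s + 4 - i : ℕ) : ℤ) ((Nat.lcmUpto n : ℚ) ^ (2 * s + 4 - i)) := by
      refine PadicOrdGe.of_eq (le_of_eq ?_)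
      rw [padicValRat.pow, padicValRat.of_nat, padicValNat_lcmUpto_of_mem_phiPrimes hmem]; simp
    have ha := (isDOrdDiv_AsReg (q := p) hb.1 s δ hb.2.1.le hk (2 * s + 4 - i)).padicOrdGe le_rfl
    rw [← coeffAs] at ha
    have hΦ : PadicOrdGe p (-((s + 2 : ℕ) : ℤ)) (((PhiL n : ℚ) ^ (s + 2))⁻¹) := by
      refine PadicOrdGe.of_eq (le_of_eq ?_)
      rw [padicValRat.inv, padicValRat.pow, padicValRat.of_nat, padicValNat_PhiL_of_mem hmem]; simp
    have h1 := one_le_padicValRat_Qk_neg hmem hk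
    refine ((hd.mul ha).mul hΦ).mono ?_
    push_cast
    nlinarith
  · obtain ⟨z, hz⟩ := exists_int_lcm_pow_mul_coeffAs s δ n hk i
    have hΦ : PadicOrdGe p 0 (((PhiL n : ℚ) ^ (s + 2))⁻¹) := by
      refine PadicOrdGe.of_eq (le_of_eq ?_)
      rw [padicValRat.inv, padicValRat.pow, padicValRat.of_nat, padicValNat_PhiL_of_not_mem hmem]; simp
    have hz' : PadicOrdGe p 0 ((Nat.lcmUpto n : ℚ) ^ (2 * s + 4 - i) * coeffAs s δ n i k) := by
      rw [hz]; exact PadicOrdGe.of_int z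
    simpa using hz'.mul hΦ

/-! ## §6. Lemma 4.5 and Lemma 4.6 with the factor `Φ_n^{−s−2}` -/

/-- **Lemma 4.5 (rho_i_ari):** `Φ_n^{−s−2}·d_n^{2s+4−i}·ρ_{n,i} ∈ ℤ`. [cite: Lai2025TwoAdicZeta, Lemma 4.5 (rho_i_ari)] -/
theorem exists_int_phi_rhoI (s δ n i : ℕ) :
    ∃ z : ℤ, (Nat.lcmUpto n : ℚ) ^ (2 * s + 4 - i) * rhoI s δ n i / (PhiL n : ℚ) ^ (s + 2) = z := by
  have h : ∀ k ∈ range (n + 1), ∃ z : ℤ,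
      (Nat.lcmUpto n : ℚ) ^ (2 * s + 4 - i) * coeffAs s δ n i k / (PhiL n : ℚ) ^ (s + 2) = z :=
    fun k hk => exists_int_phi_coeffAs s δ n (by have := mem_range.1 hk; omega) i
  choose! z hz using h
  have hsum : (Nat.lcmUpto n : ℚ) ^ (2 * s + 4 - i) * (∑ k ∈ range (n + 1), coeffAs s δ n i k) / (PhiL n : ℚ) ^ (s + 2) =
      ∑ k ∈ range (n + 1), (z k : ℚ) := by
    rw [mul_sum, sum_div]; exact sum_congr rfl hz
  refine ⟨(-1) ^ s * (i.ascFactorial (s + 1) : ℤ) * 4 ^ (i + s) * ∑ k ∈ range (n + 1), z k, ?_⟩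
  calc (Nat.lcmUpto n : ℚ) ^ (2 * s + 4 - i) * rhoI s δ n i / (PhiL n : ℚ) ^ (s + 2)
      = (-1) ^ s * (i.ascFactorial (s + 1) : ℚ) * 4 ^ (i + s) *
        ((Nat.lcmUpto n : ℚ) ^ (2 * s + 4 - i) * (∑ k ∈ range (n + 1), coeffAs s δ n i k) / (PhiL n : ℚ) ^ (s + 2)) := by
        rw [rhoI]; ring
    _ = _ := by rw [hsum]; push_cast; ring

/-- In particular `Φ_n^{−s−2}·d_n^{3s+5}·ρ_{n,i} ∈ ℤ`. [cite: Lai2025TwoAdicZeta, §7 (proof of Thm 1.2: "Φ_n^{−s−2}d_n^{3s+5}S_n is a linear combination … with integer coefficients")] -/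
theorem exists_int_phi_rhoI' (s δ n i : ℕ) :
    ∃ z : ℤ, (Nat.lcmUpto n : ℚ) ^ (3 * s + 5) * rhoI s δ n i / (PhiL n : ℚ) ^ (s + 2) = z := by
  obtain ⟨z, hz⟩ := exists_int_phi_rhoI s δ n i
  refine ⟨(Nat.lcmUpto n : ℤ) ^ (3 * s + 5 - (2 * s + 4 - i)) * z, ?_⟩
  push_cast
  rw [← hz, ← mul_div_assoc, ← mul_assoc, ← pow_add]
  congr 3
  omega

/-- `q`-integrality of one refined term: if `‖d_n/N‖_q ≤ 1` then `‖Φ_n^{−s−2}d_n^{3s+5}·X_{n,k}(N/4)‖_q ≤ 1` (`k ≤ n`), since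
`Φ_n^{−s−2}d_n^{3s+5}(i)_{s+1}a_{n,i,k}(N/4)^{−(i+s+1)} = (i)_{s+1}4^{i+s+1}·(Φ_n^{−s−2}d_n^{2s+4−i}a_{n,i,k})·(d_n/N)^{i+s+1}`
with `Φ_n^{−s−2}d_n^{2s+4−i}a_{n,i,k} ∈ ℤ` (Lemma 4.3). [cite: Lai2025TwoAdicZeta, Lemma 4.6 (proof: "we have by (strong_ari_a) that v_q(Φ_n^{−s−2}d_n^{2s+4−i₀}a_{n,i₀,k₀}) ≥ 0")] -/
theorem padicNorm_phi_lcm_pow_mul_XtermA_le (q : ℕ) [Fact q.Prime] (s δ n : ℕ) {k : ℕ} (hk : k ≤ n) {N : ℤ}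
    (hN : N ≠ 0) (hle : padicNorm q ((Nat.lcmUpto n : ℚ) / N) ≤ 1) :
    padicNorm q ((Nat.lcmUpto n : ℚ) ^ (3 * s + 5) * XtermA s δ n k ((N : ℚ) / 4) / (PhiL n : ℚ) ^ (s + 2)) ≤ 1 := by
  have hN' : (N : ℚ) ≠ 0 := by exact_mod_cast hN
  have hΦ : (PhiL n : ℚ) ^ (s + 2) ≠ 0 := pow_ne_zero _ (PhiL_cast_ne_zero n)
  rw [XtermA, mul_sum, sum_div]
  refine padicNorm.sum_le' (fun i hi => ?_) zero_le_one
  have hi' := mem_Icc.1 hi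
  obtain ⟨z, hz⟩ := exists_int_phi_coeffAs s δ n hk i
  set d : ℚ := (Nat.lcmUpto n : ℚ) with hd
  have e : d ^ (3 * s + 5) = d ^ (2 * s + 4 - i) * d ^ (i + s + 1) := by
    rw [← pow_add]; congr 1; omega
  have hexp : d ^ (3 * s + 5) * ((i.ascFactorial (s + 1) : ℚ) * coeffAs s δ n i k * ((((N : ℚ) / 4)) ^ (i + s + 1))⁻¹) /
      (PhiL n : ℚ) ^ (s + 2) =
      ((i.ascFactorial (s + 1) * 4 ^ (i + s + 1) : ℕ) : ℚ) * (z : ℚ) * (d / N) ^ (i + s + 1) := by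
    have step1 : d ^ (3 * s + 5) * ((i.ascFactorial (s + 1) : ℚ) * coeffAs s δ n i k *
        ((((N : ℚ) / 4)) ^ (i + s + 1))⁻¹) / (PhiL n : ℚ) ^ (s + 2) =
        (i.ascFactorial (s + 1) : ℚ) * (d ^ (2 * s + 4 - i) * coeffAs s δ n i k / (PhiL n : ℚ) ^ (s + 2)) *
          (d ^ (i + s + 1) * ((((N : ℚ) / 4)) ^ (i + s + 1))⁻¹) := by
      rw [e]; ring
    rw [step1, hz, ← inv_pow, ← mul_pow, show d * (((N : ℚ) / 4))⁻¹ = 4 * (d / N) by field_simp, mul_pow]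
    push_cast
    ring
  rw [hexp, padicNorm.mul, padicNorm.mul, IsAbsoluteValue.abv_pow (padicNorm q)]
  exact mul_le_one₀ (mul_le_one₀ (padicNorm.of_nat _) (padicNorm.nonneg _) (padicNorm.of_int _))
    (pow_nonneg (padicNorm.nonneg _) _) (pow_le_one₀ (padicNorm.nonneg _) hle)

/-- **Each term of `ρ_{n,0}` is `Φ_n^{−s−2}d_n^{3s+5}`-integral:** `Φ_n^{−s−2}d_n^{3s+5}·X_{n,k}(ℓ+¼) ∈ ℤ` for `0 ≤ ℓ < k ≤ n`
(`δ ≤ 1`) — at a prime `q` with `v_q(4ℓ+1) ≤ v_q(d_n)` directly, otherwise through the root relation at `m = k − ℓ`, all of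
whose other terms are `q`-integral (no two bad shifts, tree `not_dvd_both`): the printed argument by contradiction.
[cite: Lai2025TwoAdicZeta, Lemma 4.6 (proof)] -/
theorem exists_int_phi_XtermA (s : ℕ) {δ : ℕ} (hδ : δ ≤ 1) (n : ℕ) {k ℓ : ℕ} (hk : k ≤ n) (hℓ : ℓ < k) :
    ∃ z : ℤ, (z : ℚ) = (Nat.lcmUpto n : ℚ) ^ (3 * s + 5) * XtermA s δ n k ((ℓ : ℚ) + 1 / 4) / (PhiL n : ℚ) ^ (s + 2) := by
  refine Literature.Algebra.Module.Rat.exists_int_eq_of_forall_padicNorm_le_one _ fun q hq => ?_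
  haveI : Fact q.Prime := ⟨hq⟩
  have hN : (4 * (ℓ : ℤ) + 1 : ℤ) ≠ 0 := by omega
  have hy : ((ℓ : ℚ) + 1 / 4) = (((4 * (ℓ : ℤ) + 1 : ℤ)) : ℚ) / 4 := by push_cast; ring
  by_cases hgood : padicNorm q ((Nat.lcmUpto n : ℚ) / ((4 * (ℓ : ℤ) + 1 : ℤ) : ℚ)) ≤ 1
  · rw [hy]
    exact padicNorm_phi_lcm_pow_mul_XtermA_le q s δ n hk hN hgood
  · -- the bad case: use the root relation at `m = k − ℓ`
    have hbad := pow_log_succ_dvd_of_one_lt_padicNorm q n hN (not_le.1 hgood)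
    have hm1 : 1 ≤ k - ℓ := by omega
    have hmn : k - ℓ ≤ n := by omega
    have hroot := sum_XtermA_root_eq_zero s hδ n hm1 hmn
    rw [← add_sum_erase _ _ (mem_range.2 (by omega : k < n + 1))] at hroot
    have hkk : (1 : ℚ) / 4 - ((k - ℓ : ℕ) : ℚ) + k = (ℓ : ℚ) + 1 / 4 := by
      rw [Nat.cast_sub hℓ.le]; ring
    rw [hkk] at hroot
    have hX : (Nat.lcmUpto n : ℚ) ^ (3 * s + 5) * XtermA s δ n k ((ℓ : ℚ) + 1 / 4) / (PhiL n : ℚ) ^ (s + 2) =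
        -∑ k' ∈ (range (n + 1)).erase k,
          (Nat.lcmUpto n : ℚ) ^ (3 * s + 5) * XtermA s δ n k' ((1 : ℚ) / 4 - ((k - ℓ : ℕ) : ℚ) + k') /
            (PhiL n : ℚ) ^ (s + 2) := by
      rw [← sum_div, ← mul_sum, ← neg_div, ← mul_neg]
      congr 2
      linarith
    rw [hX, padicNorm.neg]
    refine padicNorm.sum_le' (fun k' hk' => ?_) zero_le_one
    have hk'k : k' ≠ k := (mem_erase.1 hk').1
    have hk'n : k' ≤ n := by have := mem_range.1 (mem_of_mem_erase hk'); omega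
    have hN' : (4 * ((k' : ℤ) - k + ℓ) + 1 : ℤ) ≠ 0 := by omega
    have hy' : (1 : ℚ) / 4 - ((k - ℓ : ℕ) : ℚ) + k' = (((4 * ((k' : ℤ) - k + ℓ) + 1 : ℤ)) : ℚ) / 4 := by
      rw [Nat.cast_sub hℓ.le]; push_cast; ring
    rw [hy']
    refine padicNorm_phi_lcm_pow_mul_XtermA_le q s δ n hk'n hN' ?_
    by_contra hgt
    exact not_dvd_both q n hk hk'n hk'k ℓ hbad (pow_log_succ_dvd_of_one_lt_padicNorm q n hN' (not_le.1 hgt))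

/-- **Lemma 4.6 (rho_0_ari), general `s`: `Φ_n^{−s−2}·d_n^{3s+5}·ρ_{n,0} ∈ ℤ`** (`δ ≤ 1`). [cite: Lai2025TwoAdicZeta, Lemma 4.6 (rho_0_ari)] -/
theorem exists_int_phi_rhoZero (s : ℕ) {δ : ℕ} (hδ : δ ≤ 1) (n : ℕ) :
    ∃ z : ℤ, (Nat.lcmUpto n : ℚ) ^ (3 * s + 5) * rhoZero s δ n / (PhiL n : ℚ) ^ (s + 2) = z := by
  have h : ∀ k ∈ range (n + 1), ∀ ℓ ∈ range k, ∃ z : ℤ,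
      (z : ℚ) = (Nat.lcmUpto n : ℚ) ^ (3 * s + 5) * XtermA s δ n k ((ℓ : ℚ) + 1 / 4) / (PhiL n : ℚ) ^ (s + 2) :=
    fun k hk ℓ hℓ => exists_int_phi_XtermA s hδ n (by have := mem_range.1 hk; omega) (mem_range.1 hℓ)
  choose! z hz using h
  refine ⟨(-1) ^ (s + 1) * ∑ k ∈ range (n + 1), ∑ ℓ ∈ range k, z k ℓ, ?_⟩
  rw [rhoZero, mul_left_comm, mul_div_assoc, mul_sum, sum_div]
  push_cast
  congr 1
  refine sum_congr rfl fun k hk => ?_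
  rw [mul_sum, sum_div]
  exact sum_congr rfl fun ℓ hℓ => (hz k hk ℓ hℓ).symm

end Literature.NumberTheory.Irrationality.Lai2025TwoAdic
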